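/-
Copyright: statement-level skeleton of a published paper (lit-balaban cell, Phase-2 proof seat p32 gen 49). No claims beyond
what the kernel checks below.
-/
import Literature.MathematicalPhysics.QuantumFieldTheory.Balaban1983to89.B3Eq121LetterClassOrders

/-!
# B3 — T. Bałaban, *(Higgs)₂,₃ quantum fields in a finite volume. III. Renormalization*, CMP **88** (1983) 411–445
[Balaban1983Higgs3], p. 416 [PDF 6] (1.21), p. 417 [PDF 7] (the insertion of δm²), (1.23) p. 417:
**THE INSERTION OF δm² = Σ_{2≦α+2β≦4} e^αλ^β δm²_{(α,β)} INTO THE EXPANSION (1.21)** — the substitution morphism of p. 417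
CONSTRUCTED on formal two-point series with (noncommutative) matrix-kernel coefficients, and the lineage's resummed (1.21)
AFTER the insertion, as an identity of formal power series in the two couplings λ, e

statement-level skeleton of published theorems with citation tags; proofs where landed; nothing here is a claim about
the Yang–Mills mass gap

HEAD VIEW
```
object        : print's p. 417 step «we write δm² = Σ_{2≦α+2β≦4} e^αλ^βδm²_{(α,β)} and we insert this into Σ^ε. This gives us
                an expansion of Σ^ε in coupling constants», performed on the two-point expansion (1.21)
                G^ε = Σ_n C₀^ε[X C₀^ε]ⁿ of the lineage, which is graded by THREE formal letters (λ, e, δm²) (p32 gen 48)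
given         : g48's `B3Eq121LetterClassOrders.eq121_weightedClassValue_letterDeg` / `eq121_classValue_letterDeg` — r15's
                resummed form `Eq121 G (C C₀) X` in `(Matrix IS IS ℝ)[[λ, e, δm²]]`, hypothesis-free — and `eq121_map`
                (any ring morphism transports `Eq121`); Mathlib's substitution of power series `MvPowerSeries.subst`, stated
                for COMMUTATIVE coefficient rings only
environment   : FILE 1 `B3Eq121OnePIChains` (graded families `sigmaSeries` / `greenSeries`), r15's `B3Sect1TwoPoint`
                (`Eq121`, `dysonTerm`, `idx123`), p37's `classRegrouping` / `objValue`, FILE E's weights, g48's `letterDeg`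
action        : (§1) the exchange isomorphism `(Matrix m m A)[[σ]] ≃+* Matrix m m (A[[σ]])`; (§2) the INSERTION MORPHISM
                `insert : (Matrix m m A)[[σ]] →+* (Matrix m m A)[[τ]]` = Mathlib's `subst a` entry by entry (the inserted
                series are scalar, i.e. central among the kernels), with its coefficient formula, `insert (C M) = C M`,
                `insert (M X^d) = (Π_s (a s)^{d s})·M`, constant terms untouched; (§3) in any `R[[τ]]`: a solution of
                `G = C₀ + GXC₀` with `X` free of constant term IS the sum of the printed series, order by order a finite sum,
                and unique; (§4) graded families under `insert` (coefficients = finite sums over the graphs of bounded order;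
                the inserted letter series as a convergent sum over the graphs); (§5) print's datum λ ↦ λ, e ↦ e,
                δm² ↦ `dm2Series δ` = Σ_{(α,β)∈idx123} e^αλ^βδ_{αβ} (coefficients supplied; r15's `dm2Coeff` is the instance
                of record), `HasSubst`; (§6) the lineage's (1.21) AFTER the insertion in `(Matrix IS IS ℝ)[[λ, e]]`
not claimed   : the order-≦-4 truncation and the recursion for δm²_{(α,β)} (p26's `B3Eq123Counterterms.recursion_order_four` is
                the member of record); any identification of the supplied δ_{αβ} with Σ_x ε^dΣ^ε_{(α,β)}(x) beyond r15's
                `dm2Coeff` BY NAME; no bare `−δm²` letter (g47/g48 scope); nothing analytic (no ε → 0)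
```

PDF held: `paper:balaban1983-higgs-2-3-quantum-fields-finite-volume` (journal page = PDF page + 410); pp. 416–417 re-read this
session in the store's text layer (`lit read`, files p0006.txt / p0007.txt).

CITATION HEADER (lean-in-tree rule).  lit-balaban TYPED SKELETON (HOME `run/shared/lean/pub/lit-balaban/`), PHASE 2, seat p32
gen 49 (unit `lit-balaban-p32`; TAKING #1, HOME/STATUS.md 2026-08-25T07:57Z; free-target protocol G.5-34(d); item (ε) of the
p32 gen-48 HANDOFF block), rows **B3.Eq1.19-1.22** ((1.21) p. 416) and **B3.Eq1.23** ((1.23) and the defining equations p. 417)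
of `HOME/lit-balaban-r15/ROWS-B3.md` (fold owner r15, referee ref-4; both heads are `proved`; this file is an OPTIONAL located
member of the p. 417 insertion sentence, ZERO head weight).  It CLOSES item (i) of the HONEST SCOPE of g48's
`B3Eq121LetterClassOrders` («the two-letter (e, λ)-grading after the insertion is NOT constructed … Mathlib's substitution of
power series is stated for commutative coefficients»).  CONSUMES BY NAME: r15's `B3Sect1TwoPoint.{Eq121, dysonTerm,
dyson_partial, idx123}`, FILE 1's `B3Eq121OnePIChains.{sigmaSeries, greenSeries, coeff_sigmaSeries, constantCoeff_sigmaSeries,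
eq121_greenSeries}`, p37's `B3ChainRegroupingValues.{objValue, objOrder, LetterDressing}` / `B3OnePIChainClassValues.classRegrouping`,
FILE E's `B3Eq121SymmetryWeights.{termWeight, letterWeight}`, g48's `B3Eq121LetterClassOrders.{letterDeg, letterDeg_ne_zero,
finite_letterDeg_eq, finite_letterDeg_degree_le, orderVec_apply_zero/one/two, n17, eq121_weightedClassValue_letterDeg,
eq121_classValue_letterDeg, eq121_map}`, p33's `B3ClassOrders420.{dsG, dvG}`, p32's `B3OnePIChainClasses.{LetterClass, rep}`;
Mathlib's `MvPowerSeries.{subst, substAlgHom, HasSubst, hasSubst_of_constantCoeff_zero, coeff_subst, subst_monomial, subst_C,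
le_order_prod, le_order_pow_of_constantCoeff_eq_zero, coeff_of_lt_order, invOfUnit}`, `Finsupp.finite_of_degree_le`,
`MvPowerSeries.WithPiTopology.hasSum_iff_hasSum_coeff`.  Nothing re-declared; no declaration is added to another file's namespace.

THE PRINTED TEXT (verbatim).  p. 416 [PDF 6]: *"The function G^ε has a perturbative expansion of the following structure
G^ε = Σ_{n=0}^{∞} C^ε_0[(−δm² + Σ^ε + ∂^{ε*}Σ^ε_1 + Σ^{ε*}_1∂^ε + ∂^{ε*}Σ^ε_2∂^ε)C^ε_0]ⁿ, (1.21)"*.  p. 417 [PDF 7]: *"The mass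
renormalization counterterm δm² is chosen in such a way that −δm² + Σ^ε is convergent. Of course this condition does not
determine δm² uniquely, and usually it is defined as a solution of the equation −δm² + Σ_{x∈T_ε} ε^dΣ^ε(x) = 0. This equation
can be solved recursively if δm² and Σ^ε are expanded into power series in e, λ. In our case δm² will be defined by the terms of
order ≦ 4. More exactly we write δm² = Σ_{2≦α+2β≦4} e^αλ^βδm²_{(α,β)} and we insert this into Σ^ε. This gives us an expansion
of Σ^ε in coupling constants and we take a sum of terms of order ≦ 4 : Σ_{2≦α+2β≦4} e^αλ^βΣ^ε_{(α,β)}. The counterterms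
δm²_{(α,β)} are defined by the equations −δm²_{(α,β)} + Σ_{x∈T_ε} ε^dΣ^ε_{(α,β)}(x) = 0."*

KIND: located bookkeeping member of a printed step (G.5-54): print performs the insertion on formal series in e, λ without
comment; on the lineage's model the kernels are matrices indexed by pairs of lattice points (a noncommutative ring), so the
insertion is a ring morphism of formal series with noncommutative coefficients substituting CENTRAL series for the letters —
constructed here by conjugating Mathlib's commutative substitution with the exchange isomorphism of §1.

WHAT IS PROVED (definitions with bodies (bookkeeping) + theorems; no `Prop` fact, no `sorry`; standard axioms).
* `§1` `toMatrix` / `ofMatrix` / **`seriesMatrixEquiv`** `: (Matrix m m A)[[σ]] ≃+* Matrix m m (A[[σ]])` (any semiring `A`),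
  `toMatrix_mul`, `toMatrix_C`, `toMatrix_monomial`, coefficient lemmas.
* `§2` **`insert ha`** `: (Matrix m m A)[[σ]] →+* (Matrix m m A)[[τ]]` for `a : σ → A[[τ]]` with `HasSubst a` (`A` commutative);
  `coeff_insert_apply` (entrywise = `subst a`), **`coeff_insert_apply_eq_finsum`**, **`insert_C`**, **`insert_monomial`**,
  **`insert_X`**, `coeff_map_scalar_mul_C`, `constantCoeff_monSubst_eq_zero` / `_zero`, **`constantCoeff_insert`**,
  `degree_le_order_monSubst`, `coeff_monSubst_eq_zero_of_lt`, **`coeff_insert`** (finite-sum coefficient formula, `σ` finite).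
* `§3` (any ring `R`, any `τ`; `X` without constant term) `coeff_mul_eq_zero_of_lt_order`, `coeff_dysonTerm_eq_zero_of_lt`,
  **`coeff_eq_sum_dysonTerm_of_eq121`**, **`hasSum_dysonTerm_of_eq121`**, `eq_tsum_dysonTerm_of_eq121`,
  **`eq_of_eq121_of_eq121`** (uniqueness: `1 − XC₀` is a unit).
* `§4` (graded families `amp : ι → Matrix m m A`, `deg : ι → σ →₀ ℕ`, locally finite, positive orders)
  `constantCoeff_insert_sigmaSeries`, **`eq121_insert_greenSeries`**, `hasSum_dysonTerm_insert_greenSeries`,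
  `coeff_insert_greenSeries_eq_sum_dysonTerm`, `eq121_iff_eq_insert_greenSeries`, `finite_degree_deg_le`,
  **`coeff_insert_sigmaSeries`** (the coefficient at order `e` = the finite sum over the graphs of total order `≤ degree e`),
  **`hasSum_insert_sigmaSeries`** (`insert (Σ_i K_i X^{deg i}) = Σ'_i (Π_s (a s)^{(deg i) s})·K_i`).
* `§5` **`dm2Series δ`** (= Σ_{(α,β)∈idx123} e^αλ^β δ_{αβ} in `ℝ[[λ, e]]`), `constantCoeff_dm2Series` (= 0: every order of (1.23)
  has 2 ≦ α + 2β), `dm2Term_eq_monomial`, `dm2Exponent_injective`, **`coeff_dm2Series`** (the coefficient of e^αλ^β IS δ_{αβ} on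
  the seven orders of (1.23), 0 otherwise), **`a123 δ`** `= (λ, e, dm2Series δ)`, `constantCoeff_a123`, **`hasSubst_a123`**, `monSubst_a123`,
  **`insert123 δ`**, `insert123_X_zero` (λ ↦ λ), `insert123_X_one` (e ↦ e), **`insert123_X_two`** (δm² ↦ δm²(e, λ)),
  `insert123_C`, `insert123_monomial`.
* `§6` **`eq121_weightedClassValue_inserted`** / `eq121_classValue_inserted` ((1.21) after the insertion in `(Matrix IS IS ℝ)[[λ, e]]`),
  `constantCoeff_letterSeries_inserted`, **`coeff_letterSeries_inserted`** («an expansion of Σ^ε in coupling constants»: the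
  order-(β, α) coefficient is the finite sum over the letter classes with d_s + d_v + n17 ≤ α + β), **`hasSum_letterSeries_inserted`**,
  `weightedClassValue_inserted_eq_tsum_dysonTerm` (the printed series in (λ, e)), `coeff_weightedClassValue_inserted_eq_sum_dysonTerm`
  (order by order), `eq121_iff_eq_weightedClassValue_inserted` (uniqueness).
HONEST SCOPE.  (i) The coefficients δ_{αβ} of the inserted polynomial are a PARAMETER (`δ : ℕ → ℕ → ℝ`); print defines them by
−δm²_{(α,β)} + Σ_xε^dΣ^ε_{(α,β)}(x) = 0, whose data-level form is r15's `B3Sect1TwoPoint.dm2Coeff` and whose recursion through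
order 4 is p26's `B3Eq123Counterterms.recursion_order_four`; neither the recursion nor the truncation «we take a sum of terms of
order ≦ 4» is re-proved here, and no triangularity of the inserted expansion is claimed.  (ii) The letter families are those of
p37 / FILE E / g48 on p18's carrier (all of (1.6)–(1.15); no bare `−δm²` letter; no sorting into Σ^ε, ∂^{ε*}Σ^ε_1, …; dressings a
parameter); the insertion applies verbatim to any subfamily.  (iii) `insert` is built for matrix-kernel rings `Matrix m m A` over a
commutative `A` (the lineage's kernel ring `Matrix IS IS ℝ`), not for an arbitrary noncommutative algebra.  (iv) Nothing analytic:
formal power series throughout, as on p. 417 («expanded into power series in e, λ»).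
Unit `lit-balaban-p32` gen 49 (literature-prover-lit-balaban-p32-g49-0), HOME `run/shared/lean/pub/lit-balaban/`, 2026-08-25.
-/

open Finset MvPowerSeries
open scoped BigOperators

namespace Literature.MathematicalPhysics.QuantumFieldTheory.Balaban1983to89.B3Eq121CouplingInsertion

open B3Sect1TwoPoint (dysonTerm Eq121 dyson_partial)

/-! ## §1 The exchange isomorphism `(Matrix m m A)[[σ]] ≃+* Matrix m m (A[[σ]])` -/

section Exchange

variable {σ : Type*} {m : Type*} {A : Type*}

/-- The entries of a formal power series with matrix coefficients, as formal power series: `(toMatrix f)_{ij} = Σ_d (f_d)_{ij} X^d`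
(bookkeeping for the p. 417 insertion on kernels indexed by pairs of lattice points). [cite: Balaban1983Higgs3, (1.21) p.416] -/
def toMatrix (f : MvPowerSeries σ (Matrix m m A)) : Matrix m m (MvPowerSeries σ A) :=
  Matrix.of fun i j => fun d => f d i j

/-- A matrix of formal power series as a formal power series with matrix coefficients. [cite: Balaban1983Higgs3, (1.21) p.416] -/
def ofMatrix (F : Matrix m m (MvPowerSeries σ A)) : MvPowerSeries σ (Matrix m m A) :=
  fun d => Matrix.of fun i j => F i j d

/-- kernel: `ofMatrix ∘ toMatrix = id`. [cite: Balaban1983Higgs3, (1.21) p.416] -/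
theorem ofMatrix_toMatrix (f : MvPowerSeries σ (Matrix m m A)) : ofMatrix (toMatrix f) = f := rfl

/-- kernel: `toMatrix ∘ ofMatrix = id`. [cite: Balaban1983Higgs3, (1.21) p.416] -/
theorem toMatrix_ofMatrix (F : Matrix m m (MvPowerSeries σ A)) : toMatrix (ofMatrix F) = F := rfl

variable [Fintype m] [DecidableEq m] [Semiring A]

/-- kernel: coefficients of the entries. [cite: Balaban1983Higgs3, (1.21) p.416] -/
@[simp] theorem coeff_toMatrix (f : MvPowerSeries σ (Matrix m m A)) (i j : m) (d : σ →₀ ℕ) :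
    coeff d (toMatrix f i j) = coeff d f i j := rfl

/-- kernel: entries of the coefficients. [cite: Balaban1983Higgs3, (1.21) p.416] -/
@[simp] theorem coeff_ofMatrix (F : Matrix m m (MvPowerSeries σ A)) (d : σ →₀ ℕ) (i j : m) :
    coeff d (ofMatrix F) i j = coeff d (F i j) := rfl

/-- kernel: `toMatrix` is multiplicative (the Cauchy product of matrix coefficients, entry by entry).
[cite: Balaban1983Higgs3, (1.21) p.416] -/
theorem toMatrix_mul (f g : MvPowerSeries σ (Matrix m m A)) :
    toMatrix (f * g) = toMatrix f * toMatrix g := by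
  classical
  ext i j d
  rw [coeff_toMatrix, coeff_mul, Matrix.sum_apply, Matrix.mul_apply]
  simp_rw [Matrix.mul_apply, map_sum, coeff_mul, coeff_toMatrix]
  exact Finset.sum_comm

/-- kernel: `toMatrix` is additive. [cite: Balaban1983Higgs3, (1.21) p.416] -/
theorem toMatrix_add (f g : MvPowerSeries σ (Matrix m m A)) :
    toMatrix (f + g) = toMatrix f + toMatrix g := rfl

variable (σ m A) in
/-- **THE EXCHANGE ISOMORPHISM** `(Matrix m m A)[[σ]] ≃+* Matrix m m (A[[σ]])` (a formal series of matrices is a matrix of formal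
series; Mathlib has the polynomial analogue `matPolyEquiv` only). [cite: Balaban1983Higgs3, (1.21) p.416] -/
def seriesMatrixEquiv : MvPowerSeries σ (Matrix m m A) ≃+* Matrix m m (MvPowerSeries σ A) where
  toFun := toMatrix
  invFun := ofMatrix
  left_inv := ofMatrix_toMatrix
  right_inv := toMatrix_ofMatrix
  map_mul' := toMatrix_mul
  map_add' := toMatrix_add

/-- kernel. [cite: Balaban1983Higgs3, (1.21) p.416] -/
@[simp] theorem seriesMatrixEquiv_apply (f : MvPowerSeries σ (Matrix m m A)) :
    seriesMatrixEquiv σ m A f = toMatrix f := rfl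

/-- kernel. [cite: Balaban1983Higgs3, (1.21) p.416] -/
@[simp] theorem seriesMatrixEquiv_symm_apply (F : Matrix m m (MvPowerSeries σ A)) :
    (seriesMatrixEquiv σ m A).symm F = ofMatrix F := rfl

/-- kernel: the entries of a constant series are the constants of the entries. [cite: Balaban1983Higgs3, (1.21) p.416] -/
theorem toMatrix_C (M : Matrix m m A) : toMatrix (C (σ := σ) M) = M.map (C (σ := σ)) := by
  classical
  ext i j d
  rw [coeff_toMatrix, Matrix.map_apply, coeff_C, coeff_C]
  split_ifs <;> rfl

/-- kernel: the entries of a monomial `M·X^d` are the monomials `M_{ij}X^d`. [cite: Balaban1983Higgs3, (1.21) p.416] -/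
theorem toMatrix_monomial (d : σ →₀ ℕ) (M : Matrix m m A) :
    toMatrix (monomial d M) = M.map (monomial d) := by
  classical
  ext i j n
  rw [coeff_toMatrix, Matrix.map_apply, coeff_monomial, coeff_monomial]
  split_ifs <;> rfl

end Exchange

/-! ## §2 The insertion morphism: substituting central power series for the letters of a series with matrix coefficients -/

section Insert

variable {σ τ : Type*} {m : Type*} [Fintype m] [DecidableEq m] {A : Type*} [CommRing A]
  {a : σ → MvPowerSeries τ A}

/-- **THE INSERTION MORPHISM** (the shape of p. 417 *"we write δm² = Σ_{2≦α+2β≦4} e^αλ^βδm²_{(α,β)} and we insert this into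
Σ^ε"*): substitute the formal series `a s ∈ A[[τ]]` (central in the kernel ring) for the letters `s : σ` of a formal series with
MATRIX coefficients — Mathlib's `MvPowerSeries.subst a` applied entry by entry through `seriesMatrixEquiv`; a RING MORPHISM
`(Matrix m m A)[[σ]] →+* (Matrix m m A)[[τ]]`. [cite: Balaban1983Higgs3, p.417] [cite: Balaban1983Higgs3, (1.21) p.416] -/
noncomputable def insert (ha : HasSubst a) : MvPowerSeries σ (Matrix m m A) →+* MvPowerSeries τ (Matrix m m A) :=
  (seriesMatrixEquiv τ m A).symm.toRingHom.comp
    (((substAlgHom ha).toRingHom.mapMatrix).comp (seriesMatrixEquiv σ m A).toRingHom)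

/-- kernel: `insert f = ofMatrix ((toMatrix f).map (subst a))`. [cite: Balaban1983Higgs3, p.417] -/
theorem insert_apply (ha : HasSubst a) (f : MvPowerSeries σ (Matrix m m A)) :
    insert ha f = ofMatrix ((toMatrix f).map (subst a)) := by
  simp [insert, RingHom.mapMatrix_apply, coe_substAlgHom]

/-- **ENTRYWISE, THE INSERTION IS MATHLIB'S SUBSTITUTION** `MvPowerSeries.subst a`. [cite: Balaban1983Higgs3, p.417] -/
theorem coeff_insert_apply (ha : HasSubst a) (f : MvPowerSeries σ (Matrix m m A)) (e : τ →₀ ℕ) (i j : m) :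
    coeff e (insert ha f) i j = coeff e (subst a (toMatrix f i j)) := by
  rw [insert_apply, coeff_ofMatrix, Matrix.map_apply]

/-- the series `Π_s (a s)^{d s}` substituted for the monomial `X^d`. [cite: Balaban1983Higgs3, p.417] -/
noncomputable abbrev monSubst (a : σ → MvPowerSeries τ A) (d : σ →₀ ℕ) : MvPowerSeries τ A :=
  d.prod fun s n => a s ^ n

/-- **THE COEFFICIENTS OF THE INSERTED SERIES** (entrywise): `coeff_e (insert f)_{ij} = Σᶠ_d coeff_e(Π_s (a s)^{d s}) · (coeff_d f)_{ij}`.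
[cite: Balaban1983Higgs3, p.417] -/
theorem coeff_insert_apply_eq_finsum (ha : HasSubst a) (f : MvPowerSeries σ (Matrix m m A)) (e : τ →₀ ℕ) (i j : m) :
    coeff e (insert ha f) i j = ∑ᶠ d : σ →₀ ℕ, coeff e (monSubst a d) * coeff d f i j := by
  rw [coeff_insert_apply, coeff_subst ha]
  refine finsum_congr fun d => ?_
  rw [smul_eq_mul, coeff_toMatrix, mul_comm]

/-- **THE INSERTION FIXES THE KERNELS**: `insert (C M) = C M` (in particular the free propagator `C₀^ε` of (1.21)).
[cite: Balaban1983Higgs3, p.417] [cite: Balaban1983Higgs3, (1.21) p.416] -/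
theorem insert_C (ha : HasSubst a) (M : Matrix m m A) : insert ha (C M) = C M := by
  rw [insert_apply, toMatrix_C, Matrix.map_map]
  have h : (subst a ∘ C : A → MvPowerSeries τ A) = C := by
    funext r
    exact subst_C r
  rw [h, ← toMatrix_C, ofMatrix_toMatrix]

/-- **THE INSERTION ON ONE TERM** `M·X^d` of a graph expansion: `insert (M·X^d) = (Π_s (a s)^{d s})·M`, the substituted scalar
series entering the kernel ring through `Matrix.scalar` (central). [cite: Balaban1983Higgs3, p.417] -/
theorem insert_monomial (ha : HasSubst a) (d : σ →₀ ℕ) (M : Matrix m m A) :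
    insert ha (monomial d M) = MvPowerSeries.map (Matrix.scalar m) (monSubst a d) * C M := by
  ext e i j
  rw [coeff_insert_apply, toMatrix_monomial, Matrix.map_apply, subst_monomial ha, MvPowerSeries.algebraMap_apply,
    Algebra.algebraMap_self, RingHom.id_apply, coeff_C_mul, coeff_mul_C, coeff_map, Matrix.scalar_apply,
    Matrix.diagonal_mul, mul_comm]

/-- **THE INSERTION ON A LETTER**: `insert (X s) = a s` (as a central series in the kernel ring). [cite: Balaban1983Higgs3, p.417] -/
theorem insert_X (ha : HasSubst a) (s : σ) : insert ha (X s) = MvPowerSeries.map (Matrix.scalar m) (a s) := by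
  have h : monSubst a (Finsupp.single s 1) = a s := by
    rw [monSubst, Finsupp.prod_single_index] <;> simp
  rw [show (X s : MvPowerSeries σ (Matrix m m A)) = monomial (Finsupp.single s 1) 1 from rfl, insert_monomial, h,
    map_one, mul_one]

/-- kernel: the coefficients of `(Π_s (a s)^{d s})·M`. [cite: Balaban1983Higgs3, p.417] -/
theorem coeff_map_scalar_mul_C (p : MvPowerSeries τ A) (M : Matrix m m A) (e : τ →₀ ℕ) :
    coeff e (MvPowerSeries.map (Matrix.scalar m) p * C M) = coeff e p • M := by
  ext i j
  rw [coeff_mul_C, coeff_map, Matrix.scalar_apply, Matrix.diagonal_mul, Matrix.smul_apply, smul_eq_mul]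

/-- kernel: for `d ≠ 0` the substituted monomial `Π_s (a s)^{d s}` has no constant term when the `a s` have none.
[cite: Balaban1983Higgs3, p.417] -/
theorem constantCoeff_monSubst_eq_zero (ha0 : ∀ s, constantCoeff (a s) = 0) {d : σ →₀ ℕ} (hd : d ≠ 0) :
    constantCoeff (monSubst a d) = 0 := by
  obtain ⟨s, hs⟩ : ∃ s, d s ≠ 0 := by
    by_contra! h
    exact hd (Finsupp.ext h)
  rw [monSubst, map_finsuppProd]
  exact Finset.prod_eq_zero (Finsupp.mem_support_iff.mpr hs) (by dsimp only; rw [map_pow, ha0, zero_pow hs])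

/-- kernel: `Π_s (a s)^{0} = 1`. [cite: Balaban1983Higgs3, p.417] -/
theorem constantCoeff_monSubst_zero : constantCoeff (monSubst a 0) = 1 := by
  rw [monSubst, Finsupp.prod_zero_index, map_one]

/-- **THE INSERTION DOES NOT TOUCH THE CONSTANT TERM** (the inserted series have none): `constantCoeff (insert f) = constantCoeff f`.
[cite: Balaban1983Higgs3, p.417] -/
theorem constantCoeff_insert (ha : HasSubst a) (ha0 : ∀ s, constantCoeff (a s) = 0)
    (f : MvPowerSeries σ (Matrix m m A)) : constantCoeff (insert ha f) = constantCoeff f := by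
  ext i j
  rw [← coeff_zero_eq_constantCoeff_apply, coeff_insert_apply_eq_finsum,
    finsum_eq_single _ 0 fun d hd => by
      rw [coeff_zero_eq_constantCoeff_apply, constantCoeff_monSubst_eq_zero ha0 hd, zero_mul],
    coeff_zero_eq_constantCoeff_apply, constantCoeff_monSubst_zero, one_mul, coeff_zero_eq_constantCoeff_apply]

/-- kernel: `degree d ≤ order (Π_s (a s)^{d s})` when the `a s` have no constant term — the inserted polynomial δm²(e, λ) has no
constant term, so a graph of total order `|d|` contributes only at orders `≥ |d|` in (e, λ). [cite: Balaban1983Higgs3, p.417] -/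
theorem degree_le_order_monSubst (ha0 : ∀ s, constantCoeff (a s) = 0) (d : σ →₀ ℕ) :
    (d.degree : ℕ∞) ≤ (monSubst a d).order := by
  rw [monSubst, Finsupp.prod, Finsupp.degree_apply, Nat.cast_sum]
  refine le_trans (Finset.sum_le_sum fun s _ => ?_) (le_order_prod (fun s => a s ^ d s) d.support)
  exact le_order_pow_of_constantCoeff_eq_zero (d s) (ha0 s)

/-- kernel: hence `coeff_e (Π_s (a s)^{d s}) = 0` unless `degree d ≤ degree e`. [cite: Balaban1983Higgs3, p.417] -/
theorem coeff_monSubst_eq_zero_of_lt (ha0 : ∀ s, constantCoeff (a s) = 0) {d : σ →₀ ℕ} {e : τ →₀ ℕ}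
    (h : e.degree < d.degree) : coeff e (monSubst a d) = 0 :=
  coeff_of_lt_order (lt_of_lt_of_le (by exact_mod_cast h) (degree_le_order_monSubst ha0 d))

variable [Finite σ]

/-- **THE COEFFICIENTS OF THE INSERTED SERIES ARE FINITE SUMS**: `coeff_e (insert f) = Σ_{degree d ≤ degree e} coeff_e(Π(a s)^{d s})·coeff_d f`
(as matrices). [cite: Balaban1983Higgs3, p.417] -/
theorem coeff_insert (ha : HasSubst a) (ha0 : ∀ s, constantCoeff (a s) = 0) (f : MvPowerSeries σ (Matrix m m A))
    (e : τ →₀ ℕ) :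
    coeff e (insert ha f) =
      ∑ d ∈ (Finsupp.finite_of_degree_le (σ := σ) e.degree).toFinset, coeff e (monSubst a d) • coeff d f := by
  ext i j
  rw [coeff_insert_apply_eq_finsum, Matrix.sum_apply,
    finsum_eq_sum_of_support_subset _ (s := (Finsupp.finite_of_degree_le (σ := σ) e.degree).toFinset) ?_]
  · exact Finset.sum_congr rfl fun d _ => by rw [Matrix.smul_apply, smul_eq_mul]
  · intro d hd
    rw [Set.Finite.coe_toFinset]
    show d.degree ≤ e.degree
    by_contra h
    apply hd
    dsimp only
    rw [coeff_monSubst_eq_zero_of_lt ha0 (not_le.mp h), zero_mul]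

end Insert

/-! ## §3 (1.21) in a formal-series ring `R[[τ]]` with a self-energy WITHOUT constant term: the printed series converges,
order by order it is a finite sum, and the resummed form of record has exactly one solution (any ring `R` of kernels) -/

section Dyson

open MvPowerSeries.WithPiTopology

variable {τ : Type*} {R : Type*} [Ring R]

/-- kernel: a product whose right factor has order `> degree d` has vanishing `d`-coefficient.
[cite: Balaban1983Higgs3, (1.21) p.416] -/
theorem coeff_mul_eq_zero_of_lt_order (f : MvPowerSeries τ R) {g : MvPowerSeries τ R} {d : τ →₀ ℕ}
    (h : (d.degree : ℕ∞) < g.order) : coeff d (f * g) = 0 := by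
  classical
  rw [coeff_mul]
  refine Finset.sum_eq_zero fun p hp => ?_
  have hp2 : (p.2.degree : ℕ∞) < g.order := by
    refine lt_of_le_of_lt ?_ h
    have : p.2 ≤ d := by
      rw [Finset.HasAntidiagonal.mem_antidiagonal] at hp
      rw [← hp]; exact le_add_self
    exact_mod_cast Finsupp.degree_mono this
  rw [coeff_of_lt_order hp2, mul_zero]

/-- kernel: `coeff_d (G·(XC₀)^N) = 0` for `N > degree d` when `X` has no constant term. [cite: Balaban1983Higgs3, (1.21) p.416] -/
theorem coeff_mul_pow_eq_zero_of_lt {X : MvPowerSeries τ R} (hX : constantCoeff X = 0) (G C0 : MvPowerSeries τ R)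
    {d : τ →₀ ℕ} {N : ℕ} (h : d.degree < N) : coeff d (G * (X * C0) ^ N) = 0 := by
  refine coeff_mul_eq_zero_of_lt_order G (lt_of_lt_of_le (b := (N : ℕ∞)) (by exact_mod_cast h) ?_)
  exact le_order_pow_of_constantCoeff_eq_zero N (by rw [map_mul, hX, zero_mul])

/-- **the terms `C₀[XC₀]ⁿ` of (1.21) with `n > degree d` do not contribute at order `d`** (X without constant term).
[cite: Balaban1983Higgs3, (1.21) p.416] -/
theorem coeff_dysonTerm_eq_zero_of_lt {X : MvPowerSeries τ R} (hX : constantCoeff X = 0) (C0 : MvPowerSeries τ R)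
    {d : τ →₀ ℕ} {n : ℕ} (h : d.degree < n) : coeff d (dysonTerm C0 X n) = 0 :=
  coeff_mul_pow_eq_zero_of_lt hX C0 C0 h

/-- **ORDER BY ORDER, (1.21) IS A FINITE SUM**: `coeff_d G = Σ_{n ≤ degree d} coeff_d (C₀[XC₀]ⁿ)` for every solution of the
resummed form `G = C₀ + GXC₀` with `X` free of constant term. [cite: Balaban1983Higgs3, (1.21) p.416] -/
theorem coeff_eq_sum_dysonTerm_of_eq121 {G C0 X : MvPowerSeries τ R} (hX : constantCoeff X = 0) (h : Eq121 G C0 X)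
    (d : τ →₀ ℕ) : coeff d G = ∑ n ∈ Finset.range (d.degree + 1), coeff d (dysonTerm C0 X n) := by
  conv_lhs => rw [dyson_partial h (d.degree + 1)]
  rw [map_add, coeff_mul_pow_eq_zero_of_lt hX G C0 (Nat.lt_succ_self _), add_zero, map_sum]

/-- **THE PRINTED SERIES `Σ_{n=0}^∞ C₀[XC₀]ⁿ` CONVERGES TO `G`** in `R[[τ]]` (product topology on coefficients, ANY topology on the
kernels): at each order the partial sums are eventually constant. [cite: Balaban1983Higgs3, (1.21) p.416] -/
theorem hasSum_dysonTerm_of_eq121 [TopologicalSpace R] {G C0 X : MvPowerSeries τ R} (hX : constantCoeff X = 0)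
    (h : Eq121 G C0 X) : HasSum (dysonTerm C0 X) G := by
  rw [hasSum_iff_hasSum_coeff]
  intro d
  rw [coeff_eq_sum_dysonTerm_of_eq121 hX h d]
  exact hasSum_sum_of_ne_finset_zero fun n hn => by
    simp only [Finset.mem_range, not_lt] at hn
    exact coeff_dysonTerm_eq_zero_of_lt hX C0 (by omega)

/-- (1.21) LITERALLY: `G = Σ'_n C₀[XC₀]ⁿ` (coefficients Hausdorff). [cite: Balaban1983Higgs3, (1.21) p.416] -/
theorem eq_tsum_dysonTerm_of_eq121 [TopologicalSpace R] [T2Space R] {G C0 X : MvPowerSeries τ R}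
    (hX : constantCoeff X = 0) (h : Eq121 G C0 X) : G = ∑' n, dysonTerm C0 X n :=
  (hasSum_dysonTerm_of_eq121 hX h).tsum_eq.symm

/-- **UNIQUENESS**: `1 − XC₀` is a unit of `R[[τ]]` (constant term `1`), so the resummed form `G = C₀ + GXC₀` has exactly one
solution. [cite: Balaban1983Higgs3, (1.21) p.416] -/
theorem eq_of_eq121_of_eq121 {G G' C0 X : MvPowerSeries τ R} (hX : constantCoeff X = 0) (h : Eq121 G C0 X)
    (h' : Eq121 G' C0 X) : G = G' := by
  have key : ∀ {H : MvPowerSeries τ R}, Eq121 H C0 X → H * (1 - X * C0) = C0 := fun hH => by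
    unfold Eq121 at hH
    rw [mul_sub, mul_one, ← mul_assoc, sub_eq_iff_eq_add]
    exact hH
  have hu : constantCoeff (1 - X * C0) = ((1 : Rˣ) : R) := by
    rw [Units.val_one, map_sub, map_one, map_mul, hX, zero_mul, sub_zero]
  have hz : (G - G') * (1 - X * C0) = 0 := by rw [sub_mul, key h, key h', sub_self]
  have := congrArg (· * (1 - X * C0).invOfUnit 1) hz
  simp only [zero_mul, mul_assoc, mul_invOfUnit _ _ hu, mul_one] at this
  exact sub_eq_zero.mp this

end Dyson

/-! ## §4 Graded families of kernels under the insertion: *"an expansion of Σ^ε in coupling constants"* (p. 417) -/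

section Graded

open MvPowerSeries.WithPiTopology
open B3Eq121OnePIChains (sigmaSeries greenSeries coeff_sigmaSeries constantCoeff_sigmaSeries eq121_greenSeries)

variable {σ τ : Type*} {m : Type*} [Fintype m] [DecidableEq m] {A : Type*} [CommRing A]
  {a : σ → MvPowerSeries τ A} (ha : HasSubst a) {ι : Type*} (amp : ι → Matrix m m A) (deg : ι → σ →₀ ℕ)

/-- **THE INSERTED SELF-ENERGY HAS NO CONSTANT TERM** (every member has positive order, the inserted series have no constant
term). [cite: Balaban1983Higgs3, p.417] [cite: Balaban1983Higgs3, (1.21) p.416] -/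
theorem constantCoeff_insert_sigmaSeries (ha0 : ∀ s, constantCoeff (a s) = 0) (hdeg : ∀ i, deg i ≠ 0)
    (hfin : ∀ d, {i | deg i = d}.Finite) :
    constantCoeff (insert ha (sigmaSeries amp deg)) = 0 := by
  rw [constantCoeff_insert ha ha0, constantCoeff_sigmaSeries hdeg hfin]

/-- **(1.21) AFTER THE INSERTION, for a graded family**: FILE 1's `Eq121 G (C C₀) X` for the chain series `G` and the letter
series `X` is transported by the ring morphism `insert`, which fixes `C C₀`. [cite: Balaban1983Higgs3, p.417]
[cite: Balaban1983Higgs3, (1.21) p.416] -/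
theorem eq121_insert_greenSeries (C0 : Matrix m m A) (hdeg : ∀ i, deg i ≠ 0) (hfin : ∀ d, {i | deg i = d}.Finite) :
    Eq121 (insert ha (greenSeries C0 amp deg)) (C C0) (insert ha (sigmaSeries amp deg)) := by
  have h := B3Eq121LetterClassOrders.eq121_map (insert ha) (eq121_greenSeries (C0 := C0) (amp := amp) (deg := deg) hdeg hfin)
  rwa [insert_C] at h

/-- **THE INSERTED TWO-POINT SERIES IS THE PRINTED SERIES in the new letters**: `insert G = Σ'_n C₀[(insert X)C₀]ⁿ`.
[cite: Balaban1983Higgs3, p.417] [cite: Balaban1983Higgs3, (1.21) p.416] -/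
theorem hasSum_dysonTerm_insert_greenSeries [TopologicalSpace A] (ha0 : ∀ s, constantCoeff (a s) = 0) (C0 : Matrix m m A)
    (hdeg : ∀ i, deg i ≠ 0) (hfin : ∀ d, {i | deg i = d}.Finite) :
    HasSum (dysonTerm (C C0) (insert ha (sigmaSeries amp deg))) (insert ha (greenSeries C0 amp deg)) :=
  hasSum_dysonTerm_of_eq121 (constantCoeff_insert_sigmaSeries ha amp deg ha0 hdeg hfin)
    (eq121_insert_greenSeries ha amp deg C0 hdeg hfin)

/-- **ORDER BY ORDER after the insertion**: `coeff_e (insert G) = Σ_{n ≤ degree e} coeff_e (C₀[(insert X)C₀]ⁿ)`.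
[cite: Balaban1983Higgs3, p.417] [cite: Balaban1983Higgs3, (1.21) p.416] -/
theorem coeff_insert_greenSeries_eq_sum_dysonTerm (ha0 : ∀ s, constantCoeff (a s) = 0) (C0 : Matrix m m A)
    (hdeg : ∀ i, deg i ≠ 0) (hfin : ∀ d, {i | deg i = d}.Finite) (e : τ →₀ ℕ) :
    coeff e (insert ha (greenSeries C0 amp deg)) =
      ∑ n ∈ Finset.range (e.degree + 1), coeff e (dysonTerm (C C0) (insert ha (sigmaSeries amp deg)) n) :=
  coeff_eq_sum_dysonTerm_of_eq121 (constantCoeff_insert_sigmaSeries ha amp deg ha0 hdeg hfin)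
    (eq121_insert_greenSeries ha amp deg C0 hdeg hfin) e

/-- **UNIQUENESS after the insertion**: a series `G'` in the new letters satisfies `Eq121 G' (C C₀) (insert X)` iff it is `insert G`.
[cite: Balaban1983Higgs3, p.417] [cite: Balaban1983Higgs3, (1.21) p.416] -/
theorem eq121_iff_eq_insert_greenSeries (ha0 : ∀ s, constantCoeff (a s) = 0) (C0 : Matrix m m A) (hdeg : ∀ i, deg i ≠ 0)
    (hfin : ∀ d, {i | deg i = d}.Finite) {G' : MvPowerSeries τ (Matrix m m A)} :
    Eq121 G' (C C0) (insert ha (sigmaSeries amp deg)) ↔ G' = insert ha (greenSeries C0 amp deg) :=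
  ⟨fun h => eq_of_eq121_of_eq121 (constantCoeff_insert_sigmaSeries ha amp deg ha0 hdeg hfin) h
      (eq121_insert_greenSeries ha amp deg C0 hdeg hfin),
    fun h => h ▸ eq121_insert_greenSeries ha amp deg C0 hdeg hfin⟩

variable [Finite σ]

/-- kernel: in a locally finite graded family, finitely many members have total order `≤ N`.
[cite: Balaban1983Higgs3, (1.21) p.416] -/
theorem finite_degree_deg_le (hfin : ∀ d, {i | deg i = d}.Finite) (N : ℕ) : {i | (deg i).degree ≤ N}.Finite := by
  have : {i | (deg i).degree ≤ N} = ⋃ d ∈ {d : σ →₀ ℕ | d.degree ≤ N}, {i | deg i = d} := by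
    ext i
    simp
  rw [this]
  exact (Finsupp.finite_of_degree_le N).biUnion fun d _ => hfin d

/-- **THE INSERTED SELF-ENERGY, ORDER BY ORDER** (p. 417 *"This gives us an expansion of Σ^ε in coupling constants"*): at each
order `e` in the new letters, the coefficient of the inserted series `insert (Σ_i K_i X^{deg i})` is the FINITE sum over the
members `i` of total order `≤ degree e` of `coeff_e(Π_s (a s)^{(deg i) s})·K_i`. [cite: Balaban1983Higgs3, p.417]
[cite: Balaban1983Higgs3, (1.21) p.416] -/
theorem coeff_insert_sigmaSeries (ha0 : ∀ s, constantCoeff (a s) = 0) (hfin : ∀ d, {i | deg i = d}.Finite) (e : τ →₀ ℕ) :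
    coeff e (insert ha (sigmaSeries amp deg)) =
      ∑ i ∈ (finite_degree_deg_le deg hfin e.degree).toFinset, coeff e (monSubst a (deg i)) • amp i := by
  classical
  rw [coeff_insert ha ha0]
  have hmaps : ∀ i ∈ (finite_degree_deg_le deg hfin e.degree).toFinset,
      deg i ∈ (Finsupp.finite_of_degree_le (σ := σ) e.degree).toFinset := fun i hi => by
    simp only [Set.Finite.mem_toFinset, Set.mem_setOf_eq] at hi ⊢
    exact hi
  rw [← Finset.sum_fiberwise_of_maps_to hmaps]
  refine Finset.sum_congr rfl fun d hd => ?_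
  have hset : (hfin d).toFinset = (finite_degree_deg_le deg hfin e.degree).toFinset.filter (fun i => deg i = d) := by
    ext i
    simp only [Set.Finite.mem_toFinset, Set.mem_setOf_eq, Finset.mem_filter]
    constructor
    · intro h
      simp only [Set.Finite.mem_toFinset, Set.mem_setOf_eq] at hd
      exact ⟨by rw [h]; exact hd, h⟩
    · exact fun h => h.2
  rw [coeff_sigmaSeries hfin d, hset, Finset.smul_sum]
  exact Finset.sum_congr rfl fun i hi => by rw [(Finset.mem_filter.mp hi).2]

/-- **THE INSERTED SELF-ENERGY AS A CONVERGENT SUM OVER THE GRAPHS**: `insert (Σ_i K_i X^{deg i}) = Σ'_i (Π_s (a s)^{(deg i) s})·K_i`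
in `(Matrix m m A)[[τ]]` — each graph `i` contributes its kernel times the inserted polynomial of its orders (product topology,
ANY topology on `A`; at each order only finitely many graphs contribute). [cite: Balaban1983Higgs3, p.417] [cite: Balaban1983Higgs3, (1.21) p.416] -/
theorem hasSum_insert_sigmaSeries [TopologicalSpace A] (ha0 : ∀ s, constantCoeff (a s) = 0)
    (hfin : ∀ d, {i | deg i = d}.Finite) :
    HasSum (fun i => MvPowerSeries.map (Matrix.scalar m) (monSubst a (deg i)) * C (amp i))
      (insert ha (sigmaSeries amp deg)) := by
  rw [hasSum_iff_hasSum_coeff]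
  intro e
  rw [coeff_insert_sigmaSeries ha amp deg ha0 hfin e]
  simp_rw [coeff_map_scalar_mul_C]
  exact hasSum_sum_of_ne_finset_zero fun i hi => by
    have h : e.degree < (deg i).degree := by
      simp only [Set.Finite.mem_toFinset, Set.mem_setOf_eq, not_le] at hi
      exact hi
    rw [coeff_monSubst_eq_zero_of_lt ha0 h, zero_smul]

end Graded

/-! ## §5 Print's insertion datum: λ ↦ λ, e ↦ e, δm² ↦ Σ_{2≦α+2β≦4} e^αλ^β δm²_{(α,β)} (p. 417) -/

section Print

open B3Sect1TwoPoint (idx123 idx123_eq)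

/-- **THE INSERTED MASS COUNTERTERM AS A FORMAL SERIES IN THE TWO COUPLINGS** (p. 417, verbatim: *"More exactly we write
δm² = Σ_{2≦α+2β≦4} e^αλ^βδm²_{(α,β)} and we insert this into Σ^ε"*): `Σ_{(α,β) ∈ idx123} e^αλ^β·δm²_{(α,β)}` in `ℝ[[λ, e]]`
(letters: `0 ↦ λ`, `1 ↦ e`, as in the lineage's grading (d_s, d_v, ·)), over r15's index set `idx123` and for SUPPLIED
coefficients `δ α β` (print's δm²_{(α,β)}; r15's `B3Sect1TwoPoint.dm2Coeff epsd SigmaCoeff` is the instance of record — the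
shape of r15's number `dm2Of123 e lam` with the couplings formal). [cite: Balaban1983Higgs3, (1.23) p.417] -/
noncomputable def dm2Series (δ : ℕ → ℕ → ℝ) : MvPowerSeries (Fin 2) ℝ :=
  ∑ ab ∈ idx123, X 1 ^ ab.1 * X 0 ^ ab.2 * C (δ ab.1 ab.2)

/-- **δm²(e, λ) HAS NO CONSTANT TERM** (every order of (1.23) has 2 ≦ α + 2β). [cite: Balaban1983Higgs3, (1.23) p.417] -/
theorem constantCoeff_dm2Series (δ : ℕ → ℕ → ℝ) : constantCoeff (dm2Series δ) = 0 := by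
  rw [dm2Series, map_sum]
  refine Finset.sum_eq_zero fun ab hab => ?_
  have h2 : 2 ≤ ab.1 + 2 * ab.2 := by
    simp only [idx123, Finset.mem_filter] at hab
    exact hab.2.1
  rw [map_mul, map_mul, map_pow, map_pow, constantCoeff_X, constantCoeff_X]
  rcases Nat.eq_zero_or_pos ab.1 with h | h
  · have hb : ab.2 ≠ 0 := by omega
    rw [zero_pow hb, mul_zero, zero_mul]
  · rw [zero_pow (Nat.pos_iff_ne_zero.mp h), zero_mul, zero_mul]

/-- kernel: each term `e^αλ^β·δ_{αβ}` of the inserted δm² is the monomial of exponent (β on λ, α on e).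
[cite: Balaban1983Higgs3, (1.23) p.417] -/
theorem dm2Term_eq_monomial (r : ℝ) (ab : ℕ × ℕ) :
    (X 1 ^ ab.1 * X 0 ^ ab.2 * C r : MvPowerSeries (Fin 2) ℝ) =
      monomial (Finsupp.single 1 ab.1 + Finsupp.single 0 ab.2) r := by
  rw [X_pow_eq, X_pow_eq, monomial_mul_monomial, one_mul, ← monomial_zero_eq_C_apply, monomial_mul_monomial, add_zero,
    one_mul]

/-- kernel: distinct orders (α, β) carry distinct monomials e^αλ^β. [cite: Balaban1983Higgs3, (1.23) p.417] -/
theorem dm2Exponent_injective :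
    Function.Injective fun ab : ℕ × ℕ => Finsupp.single (1 : Fin 2) ab.1 + Finsupp.single 0 ab.2 := by
  intro ab ab' h
  have h1 := DFunLike.congr_fun h 1
  have h0 := DFunLike.congr_fun h 0
  simp only [Finsupp.coe_add, Pi.add_apply, Finsupp.single_eq_same, Finsupp.single_eq_of_ne (by decide : (1 : Fin 2) ≠ 0),
    Finsupp.single_eq_of_ne (by decide : (0 : Fin 2) ≠ 1), add_zero, zero_add] at h0 h1
  exact Prod.ext h1 h0

/-- **THE COEFFICIENT OF e^αλ^β IN THE INSERTED δm² IS δm²_{(α,β)}** for the seven orders of (1.23), and `0` otherwise — print's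
*"δm² = Σ_{2≦α+2β≦4} e^αλ^βδm²_{(α,β)}"* read as a formal series in the couplings. [cite: Balaban1983Higgs3, (1.23) p.417] -/
theorem coeff_dm2Series (δ : ℕ → ℕ → ℝ) (α β : ℕ) :
    coeff (Finsupp.single 1 α + Finsupp.single 0 β) (dm2Series δ) = if (α, β) ∈ idx123 then δ α β else 0 := by
  classical
  rw [dm2Series, map_sum]
  simp_rw [dm2Term_eq_monomial, coeff_monomial]
  have key : ∀ ab : ℕ × ℕ, (Finsupp.single (1 : Fin 2) α + Finsupp.single 0 β =
      Finsupp.single 1 ab.1 + Finsupp.single 0 ab.2) ↔ (α, β) = ab := fun ab =>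
    ⟨fun h => dm2Exponent_injective (a₁ := (α, β)) (a₂ := ab) h, fun h => by rw [← h]⟩
  simp_rw [key]
  split_ifs with hmem
  · rw [Finset.sum_ite_eq, if_pos hmem]
  · rw [Finset.sum_ite_eq, if_neg hmem]

/-- **PRINT'S INSERTION DATUM**: the letter λ stays λ, e stays e, and the third letter (the δm²-insertions counted by the
lineage's grading) becomes the series `dm2Series δ`. [cite: Balaban1983Higgs3, p.417] -/
noncomputable def a123 (δ : ℕ → ℕ → ℝ) : Fin 3 → MvPowerSeries (Fin 2) ℝ :=
  ![X 0, X 1, dm2Series δ]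

/-- kernel. [cite: Balaban1983Higgs3, p.417] -/
@[simp] theorem a123_zero (δ : ℕ → ℕ → ℝ) : a123 δ 0 = X 0 := rfl

/-- kernel. [cite: Balaban1983Higgs3, p.417] -/
@[simp] theorem a123_one (δ : ℕ → ℕ → ℝ) : a123 δ 1 = X 1 := rfl

/-- kernel. [cite: Balaban1983Higgs3, p.417] -/
@[simp] theorem a123_two (δ : ℕ → ℕ → ℝ) : a123 δ 2 = dm2Series δ := rfl

/-- kernel: none of the three inserted series has a constant term. [cite: Balaban1983Higgs3, p.417] -/
theorem constantCoeff_a123 (δ : ℕ → ℕ → ℝ) : ∀ s, constantCoeff (a123 δ s) = 0 := by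
  intro s
  fin_cases s
  · exact constantCoeff_X 0
  · exact constantCoeff_X 1
  · exact constantCoeff_dm2Series δ

/-- **PRINT'S DATUM IS SUBSTITUTABLE** (Mathlib's `HasSubst`: no constant terms, finitely many letters).
[cite: Balaban1983Higgs3, p.417] -/
theorem hasSubst_a123 (δ : ℕ → ℕ → ℝ) : HasSubst (a123 δ) :=
  hasSubst_of_constantCoeff_zero (constantCoeff_a123 δ)

/-- kernel: the series inserted for the monomial `λ^{d 0} e^{d 1} (δm²)^{d 2}` is `λ^{d 0} e^{d 1} δm²(e,λ)^{d 2}`.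
[cite: Balaban1983Higgs3, p.417] -/
theorem monSubst_a123 (δ : ℕ → ℕ → ℝ) (d : Fin 3 →₀ ℕ) :
    monSubst (a123 δ) d = X 0 ^ d 0 * X 1 ^ d 1 * dm2Series δ ^ d 2 := by
  rw [monSubst, Finsupp.prod_fintype _ _ fun s => pow_zero _, Fin.prod_univ_three]
  rfl

variable {IS : Type*} [Fintype IS] [DecidableEq IS]

/-- **THE INSERTION MORPHISM OF p. 417** on formal two-point series with kernels `Matrix IS IS ℝ`:
`(Matrix IS IS ℝ)[[λ, e, δm²]] →+* (Matrix IS IS ℝ)[[λ, e]]`. [cite: Balaban1983Higgs3, p.417] -/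
noncomputable abbrev insert123 (δ : ℕ → ℕ → ℝ) :
    MvPowerSeries (Fin 3) (Matrix IS IS ℝ) →+* MvPowerSeries (Fin 2) (Matrix IS IS ℝ) :=
  insert (m := IS) (hasSubst_a123 δ)

/-- **λ STAYS λ**. [cite: Balaban1983Higgs3, p.417] -/
theorem insert123_X_zero (δ : ℕ → ℕ → ℝ) : insert123 (IS := IS) δ (X 0) = X 0 := by
  rw [insert_X, a123_zero, map_X]

/-- **e STAYS e**. [cite: Balaban1983Higgs3, p.417] -/
theorem insert123_X_one (δ : ℕ → ℕ → ℝ) : insert123 (IS := IS) δ (X 1) = X 1 := by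
  rw [insert_X, a123_one, map_X]

/-- **δm² BECOMES Σ e^αλ^βδm²_{(α,β)}** (a central series in the kernel ring). [cite: Balaban1983Higgs3, p.417] -/
theorem insert123_X_two (δ : ℕ → ℕ → ℝ) :
    insert123 (IS := IS) δ (X 2) = MvPowerSeries.map (Matrix.scalar IS) (dm2Series δ) := by
  rw [insert_X, a123_two]

/-- **THE KERNELS ARE UNTOUCHED**: `insert123 (C M) = C M`. [cite: Balaban1983Higgs3, p.417] -/
theorem insert123_C (δ : ℕ → ℕ → ℝ) (M : Matrix IS IS ℝ) : insert123 δ (C M) = C M :=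
  insert_C _ M

/-- **ONE GRAPH'S TERM**: `insert123 (M·λ^{d_s}e^{d_v}(δm²)^{n}) = (λ^{d_s}e^{d_v}δm²(e,λ)^{n})·M`.
[cite: Balaban1983Higgs3, p.417] -/
theorem insert123_monomial (δ : ℕ → ℕ → ℝ) (d : Fin 3 →₀ ℕ) (M : Matrix IS IS ℝ) :
    insert123 δ (monomial d M) =
      MvPowerSeries.map (Matrix.scalar IS) (X 0 ^ d 0 * X 1 ^ d 1 * dm2Series δ ^ d 2) * C M := by
  rw [insert_monomial, monSubst_a123]

end Print

/-! ## §6 THE LINEAGE'S (1.21) AFTER THE INSERTION: an identity in `(Matrix IS IS ℝ)[[λ, e]]` -/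

section Lineage

open MvPowerSeries.WithPiTopology
open B3Eq121OnePIChains (sigmaSeries)
open B3ChainRegroupingValues (objValue objOrder LetterDressing)
open B3OnePIChainClassValues (classRegrouping)
open B3Eq121SymmetryWeights (termWeight letterWeight)
open B3Eq121LetterClassOrders (letterDeg letterDeg_ne_zero finite_letterDeg_eq finite_letterDeg_degree_le orderVec
  eq121_weightedClassValue_letterDeg eq121_classValue_letterDeg eq121_map)
open B3OnePIChainClasses (rep)
open B3ClassOrders420 (dsG dvG)
open B3Eq121LetterClassOrders (n17)

variable {nbar : ℕ} {SF VF OF IS IV IO : Type*} [Fintype IS] [Fintype IV] [Fintype IO] [DecidableEq IS]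
  (bS : IS → SF) (bV : IV → VF) (bO : IO → OF) (C : IS → IS → ℝ)
  (Dc : LetterDressing (classRegrouping nbar) SF VF OF IS IV IO) (δ : ℕ → ℕ → ℝ)

/-- kernel: the series inserted for the monomial of a letter class `c` is `λ^{d_s}e^{d_v}δm²(e,λ)^{n17}` of its representative.
[cite: Balaban1983Higgs3, p.417] [cite: Balaban1983Higgs3, p.420] -/
theorem monSubst_a123_letterDeg (c : B3OnePIChainClasses.LetterClass nbar) :
    monSubst (a123 δ) (letterDeg c) = X 0 ^ dsG (rep c.1).G * X 1 ^ dvG (rep c.1).G * dm2Series δ ^ n17 (rep c.1).G := by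
  rw [monSubst_a123]
  simp only [letterDeg, B3Eq121LetterClassOrders.orderVec_apply_zero, B3Eq121LetterClassOrders.orderVec_apply_one,
    B3Eq121LetterClassOrders.orderVec_apply_two]

/-- **(1.21) AFTER THE INSERTION, WITH THE COMBINATORIC FACTORS WRITTEN**: r15's resummed form `Eq121 G (C C₀) X` HOLDS in
`(Matrix IS IS ℝ)[[λ, e]]` for `G` = the insertion of the lineage's symmetry-weighted class-value series and `X` = the insertion
of the symmetry-weighted letter series — g48's `eq121_weightedClassValue_letterDeg` transported by the ring morphism
`insert123 δ`, which fixes `C C₀`. [cite: Balaban1983Higgs3, (1.21) p.416] [cite: Balaban1983Higgs3, p.417] -/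
theorem eq121_weightedClassValue_inserted :
    Eq121 (insert123 δ (sigmaSeries (fun g => termWeight g • objValue (classRegrouping nbar) bS bV bO C Dc g)
        (objOrder (classRegrouping nbar) letterDeg)))
      (MvPowerSeries.C (Matrix.of C))
      (insert123 δ (sigmaSeries (fun c => letterWeight c • (Dc c).kernel bS bV bO) letterDeg)) := by
  have h := eq121_map (insert123 δ) (eq121_weightedClassValue_letterDeg bS bV bO C Dc)
  rwa [insert123_C] at h

/-- **(1.21) AFTER THE INSERTION, for p37's class values** (g48's `eq121_classValue_letterDeg` transported).
[cite: Balaban1983Higgs3, (1.21) p.416] [cite: Balaban1983Higgs3, p.417] -/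
theorem eq121_classValue_inserted :
    Eq121 (insert123 δ (sigmaSeries (objValue (classRegrouping nbar) bS bV bO C Dc) (objOrder (classRegrouping nbar) letterDeg)))
      (MvPowerSeries.C (Matrix.of C))
      (insert123 δ (sigmaSeries (fun c => (Dc c).kernel bS bV bO) letterDeg)) := by
  have h := eq121_map (insert123 δ) (eq121_classValue_letterDeg bS bV bO C Dc)
  rwa [insert123_C] at h

/-- **THE INSERTED SELF-ENERGY HAS NO CONSTANT TERM in (λ, e)**. [cite: Balaban1983Higgs3, p.417] [cite: Balaban1983Higgs3, (1.21) p.416] -/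
theorem constantCoeff_letterSeries_inserted :
    constantCoeff (insert123 δ (sigmaSeries (fun c => letterWeight c • (Dc c).kernel bS bV bO) letterDeg)) = 0 :=
  constantCoeff_insert_sigmaSeries _ _ _ (constantCoeff_a123 δ) letterDeg_ne_zero finite_letterDeg_eq

/-- **THE EXPANSION OF THE SELF-ENERGY IN THE COUPLING CONSTANTS** (p. 417 *"This gives us an expansion of Σ^ε in coupling
constants"*): at each order `e = (β, α)` in (λ, e) the coefficient of the inserted letter series is the FINITE sum, over the
letter classes `c` of total order `d_s + d_v + n17 ≤ α + β`, of `coeff_{(β,α)}(λ^{d_s}e^{d_v}δm²(e,λ)^{n17}) · (1/|Aut c|)·K(rep c)`.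
[cite: Balaban1983Higgs3, p.417] [cite: Balaban1983Higgs3, (1.21) p.416] -/
theorem coeff_letterSeries_inserted (e : Fin 2 →₀ ℕ) :
    coeff e (insert123 δ (sigmaSeries (fun c => letterWeight c • (Dc c).kernel bS bV bO) letterDeg)) =
      ∑ c ∈ (finite_letterDeg_degree_le (nbar := nbar) e.degree).toFinset,
        coeff e (X 0 ^ dsG (rep c.1).G * X 1 ^ dvG (rep c.1).G * dm2Series δ ^ n17 (rep c.1).G) •
          (letterWeight c • (Dc c).kernel bS bV bO) := by
  rw [coeff_insert_sigmaSeries _ _ _ (constantCoeff_a123 δ) finite_letterDeg_eq e]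
  exact Finset.sum_congr rfl fun c _ => by rw [monSubst_a123_letterDeg]

/-- **THE INSERTED SELF-ENERGY AS A SUM OVER THE LETTER CLASSES**: `insert123 X = Σ'_c (λ^{d_s}e^{d_v}δm²(e,λ)^{n17})·(1/|Aut c|)·K(rep c)`
in `(Matrix IS IS ℝ)[[λ, e]]`. [cite: Balaban1983Higgs3, p.417] [cite: Balaban1983Higgs3, (1.21) p.416] -/
theorem hasSum_letterSeries_inserted :
    HasSum (fun c : B3OnePIChainClasses.LetterClass nbar =>
        MvPowerSeries.map (Matrix.scalar IS) (X 0 ^ dsG (rep c.1).G * X 1 ^ dvG (rep c.1).G * dm2Series δ ^ n17 (rep c.1).G) *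
          MvPowerSeries.C (letterWeight c • (Dc c).kernel bS bV bO))
      (insert123 δ (sigmaSeries (fun c => letterWeight c • (Dc c).kernel bS bV bO) letterDeg)) := by
  have h := hasSum_insert_sigmaSeries (m := IS) (hasSubst_a123 δ) (fun c => letterWeight c • (Dc c).kernel bS bV bO)
    letterDeg (constantCoeff_a123 δ) finite_letterDeg_eq
  have hf : (fun c : B3OnePIChainClasses.LetterClass nbar =>
      MvPowerSeries.map (Matrix.scalar IS) (X 0 ^ dsG (rep c.1).G * X 1 ^ dvG (rep c.1).G * dm2Series δ ^ n17 (rep c.1).G) *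
        MvPowerSeries.C (letterWeight c • (Dc c).kernel bS bV bO)) =
      fun c => MvPowerSeries.map (Matrix.scalar IS) (monSubst (a123 δ) (letterDeg c)) *
        MvPowerSeries.C (letterWeight c • (Dc c).kernel bS bV bO) :=
    funext fun c => by rw [monSubst_a123_letterDeg]
  rw [hf]
  exact h

/-- **THE INSERTED TWO-POINT SERIES IS THE PRINTED SERIES IN (λ, e)**: `insert123 G = Σ'_n C₀[(insert123 X)C₀]ⁿ`.
[cite: Balaban1983Higgs3, (1.21) p.416] [cite: Balaban1983Higgs3, p.417] -/
theorem weightedClassValue_inserted_eq_tsum_dysonTerm :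
    insert123 δ (sigmaSeries (fun g => termWeight g • objValue (classRegrouping nbar) bS bV bO C Dc g)
        (objOrder (classRegrouping nbar) letterDeg)) =
      ∑' n, dysonTerm (MvPowerSeries.C (Matrix.of C))
        (insert123 δ (sigmaSeries (fun c => letterWeight c • (Dc c).kernel bS bV bO) letterDeg)) n :=
  eq_tsum_dysonTerm_of_eq121 (constantCoeff_letterSeries_inserted bS bV bO Dc δ)
    (eq121_weightedClassValue_inserted bS bV bO C Dc δ)

/-- **ORDER BY ORDER IN (λ, e)**: `coeff_e (insert123 G) = Σ_{n ≤ degree e} coeff_e (C₀[(insert123 X)C₀]ⁿ)` — finite sums.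
[cite: Balaban1983Higgs3, (1.21) p.416] [cite: Balaban1983Higgs3, p.417] -/
theorem coeff_weightedClassValue_inserted_eq_sum_dysonTerm (e : Fin 2 →₀ ℕ) :
    coeff e (insert123 δ (sigmaSeries (fun g => termWeight g • objValue (classRegrouping nbar) bS bV bO C Dc g)
        (objOrder (classRegrouping nbar) letterDeg))) =
      ∑ n ∈ Finset.range (e.degree + 1), coeff e (dysonTerm (MvPowerSeries.C (Matrix.of C))
        (insert123 δ (sigmaSeries (fun c => letterWeight c • (Dc c).kernel bS bV bO) letterDeg)) n) :=
  coeff_eq_sum_dysonTerm_of_eq121 (constantCoeff_letterSeries_inserted bS bV bO Dc δ)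
    (eq121_weightedClassValue_inserted bS bV bO C Dc δ) e

/-- **UNIQUENESS IN (λ, e)**: a formal series `G'` satisfies `Eq121 G' (C C₀) (insert123 X)` IFF it is `insert123 G`.
[cite: Balaban1983Higgs3, (1.21) p.416] [cite: Balaban1983Higgs3, p.417] -/
theorem eq121_iff_eq_weightedClassValue_inserted {G' : MvPowerSeries (Fin 2) (Matrix IS IS ℝ)} :
    Eq121 G' (MvPowerSeries.C (Matrix.of C))
        (insert123 δ (sigmaSeries (fun c => letterWeight c • (Dc c).kernel bS bV bO) letterDeg)) ↔
      G' = insert123 δ (sigmaSeries (fun g => termWeight g • objValue (classRegrouping nbar) bS bV bO C Dc g)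
        (objOrder (classRegrouping nbar) letterDeg)) :=
  ⟨fun h => eq_of_eq121_of_eq121 (constantCoeff_letterSeries_inserted bS bV bO Dc δ) h
      (eq121_weightedClassValue_inserted bS bV bO C Dc δ),
    fun h => h ▸ eq121_weightedClassValue_inserted bS bV bO C Dc δ⟩

end Lineage

end Literature.MathematicalPhysics.QuantumFieldTheory.Balaban1983to89.B3Eq121CouplingInsertion
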